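import Summits.ABC.IUTFork.Cor312GenuineKDeepDatum
import Literature.IUT.LogVolume.Corollary22LegendreDeepAdmissiblePairs
import Literature.IUT.LogVolume.GenuineRamificationBounds
import Literature.NumberTheory.DiophantineGeometry.AbcWave0UniformABCProofs
import HarnessLib

/-!
# [IUTchIII] Cor. 3.12, branch C «HEX-KERNEL» — the interface the assembly consumes, at the `λ_k = 1/2 + 2/7^k` datum:
# a place `x₀ | 7` of `K` with `‖t_q(x₀)‖ = 7^{−k/l}` EXACTLY (bad, tame, `e ≤ 46080·l(l−1)²(l+1)`, `d + a + b ≤ 2 + log_7(…)`)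

PROOF-ONLY support file (D-0012; 0 definitions, 0 `Prop` facts) of the abc-iut cell (Cor. 3.12 sub-crew seat abc-iut-c312-7,
gen 4; «HEX-KERNEL» brick H6 / interface «H4» in the binder order asked for by the (H5) assembler abc-iut-C-cert-1, HOME/STATUS
2026-08-26T11:39:17Z). TAKES NO SIDE on [IUTchIII] Cor. 3.12 (S. Mochizuki, *Inter-universal Teichmüller theory III*, RIMS
manuscript, Cor. 3.12 p. 173–174) or on any author.

It is `Conditional.GenuineK.exists_bad_tame_place_of_ord_neg` (this seat's `Cor312GenuineKDeepDatum`, brick H6) at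
`P := ratPoint λ_k` (`F_tpd = ℚ`), `p := 7`, `v₀ :=` the place `(7)` of `ℚ` (`e(v₀|7) = 1`), `m := 2k` — the pole order
`ord_7 j(λ_k) = −2k` being abc-iut-w5-d044's PUBLIC `Cor22.ord_jInv_lamSeven` (brick H0, p441625; originally abc-iut-S-d3's private
`ord_jInv_lam`) — for `l` prime, `l ≥ 11` (so `7 ∉ {2, 3, 5, l}`):

* `Conditional.GenuineK.exists_place_lamSeven` — ∃ `x₀ | 7` in the fibre of the index of `pilotDataOfK T.D T.K` with:
  `placeOf x₀ ∈ S`, `¬ 7 ∣ e(K_{x₀}/ℚ_7)`, `e(K_{x₀}/ℚ_7) ≤ 46080·(l(l−1)²(l+1))`,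
  `d + a + b ≤ 2 + log(46080·l(l−1)²(l+1))/log 7` ([IUTchIV] Prop. 1.1/1.2 constants, TAME form of this seat's F1), and
  **`‖t_q(x₀)‖ = 7^{−k/l}`** for the CHOSEN realising q-idele of the line of record `abc_of_SH_v6K` (all ramification indices
  cancel: `ord_w(q)/(2l·e(w|7)) = e(w|v)·2k/(2l·e(w|v)) = k/l`);
* `Conditional.GenuineK.exists_norm_qIdele_le_lamSeven` — the assembler's ONE INTERFACE verbatim:
  `∃ x₀, ‖(exists_realising_qIdeles_pilotDataOfK T.D).choose ⟨7, _⟩ x₀‖ ≤ 7^{−k/l}`.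

HONEST FRAMING: bookkeeping over OUR typed objects (a statement about the cell's sharp honestly-scaled genuine setting); nothing
here bears on the printed inequality of [IUTchIII] Cor. 3.12 or on the number-level `Cor22.Cor312AtDatum`; typed ≠ proved;
instantiated ≠ endorsed. [cite: Mochizuki2012, IUTchI Ex. 3.2 (iv) p. 71; IUTchIV Thm. 1.10 Steps (ii)–(iii) p. 24–26, Cor. 2.2 (ii) proof (P5) p. 46]
[claim: Mochizuki2012, status: disputed] for every IUT quotation.
-/

noncomputable section

open NumberField IsDedekindDomain

namespace Summit.ABC.IUTFork.Conditional

open Thm311 Thm311.Real Cor312 Cor312Prov Literature.IUT.LogVolume Literature.IUT.HodgeTheaters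
  Literature.IUT.LogThetaLattice Literature.NumberTheory.NumberFields Literature.NumberTheory.DiophantineGeometry.GenEll
  Literature.NumberTheory.DiophantineGeometry

/-- **The `λ_k` datum's deep place over `7`, with every local quantity explicit.** For `k ≥ 1`, `l` prime `≥ 11` and a genuine
Θ-volume datum `T` at `(ratPoint λ_k, l)`: a place `x₀ | 7` of `K = T.K` in the bad set of `pilotDataOfK T.D T.K`, TAME over `ℚ_7`,
of ramification `≤ 46080·l(l−1)²(l+1)`, with `d + a + b ≤ 2 + log(46080·l(l−1)²(l+1))/log 7`, at which the CHOSEN realising q-idele has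
`‖t_q(x₀)‖ = 7^{−k/l}` EXACTLY. [cite: Mochizuki2012, IUTchIV Cor. 2.2 (ii) proof (P5) p. 46; Thm. 1.10 Steps (ii)–(iii) p. 24–26]
[claim: Mochizuki2012, status: disputed] -/
theorem GenuineK.exists_place_lamSeven {k l : ℕ} (hk : 1 ≤ k) (hl : l.Prime) (h11 : 11 ≤ l)
    (T : Cor22.ThetaVolumeDatumAt (ratPoint ((2 : ℚ)⁻¹ + 2 / 7 ^ k)) l) :
    letI := T.instFieldF; letI := T.instNumberFieldF; letI := T.instAlgebraF; letI := T.instFieldK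
    letI := T.instNumberFieldK; letI := T.instAlgebraK; letI := T.instFieldFbar; letI := T.instAlgebraFbar
    letI := T.instAlgebraKFbar; letI := T.instIsElliptic
    haveI : Fact (Nat.Prime 7) := ⟨by norm_num⟩
    ∃ x₀ : (thetaIndex (pilotDataOfK T.D T.K)).Fibre (.inr ⟨7, by norm_num⟩),
      placeOf (pilotDataOfK T.D T.K) 7 x₀ ∈ (pilotDataOfK T.D T.K).S ∧
      ¬ 7 ∣ absRamificationIdx 7 (kOf (pilotDataOfK T.D T.K) 7 x₀) ∧
      absRamificationIdx 7 (kOf (pilotDataOfK T.D T.K) 7 x₀) ≤ 46080 * (l * (l - 1) ^ 2 * (l + 1)) ∧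
      differentOrd 7 (kOf (pilotDataOfK T.D T.K) 7 x₀)
          + logRadiusA 7 (absRamificationIdx 7 (kOf (pilotDataOfK T.D T.K) 7 x₀))
          + logRadiusB 7 (absRamificationIdx 7 (kOf (pilotDataOfK T.D T.K) 7 x₀)) ≤
        2 + Real.log (((46080 * (l * (l - 1) ^ 2 * (l + 1)) : ℕ) : ℝ)) / Real.log 7 ∧
      ‖(exists_realising_qIdeles_pilotDataOfK T.D).choose ⟨7, by norm_num⟩ x₀‖ = (7 : ℝ) ^ (-((k : ℝ) / l)) := by
  letI := T.instFieldF; letI := T.instNumberFieldF; letI := T.instAlgebraF; letI := T.instFieldK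
  letI := T.instNumberFieldK; letI := T.instAlgebraK; letI := T.instFieldFbar; letI := T.instAlgebraFbar
  letI := T.instAlgebraKFbar; letI := T.instIsElliptic
  haveI : Fact (Nat.Prime 7) := ⟨by norm_num⟩
  -- the place `(7)` of `ℚ = (ratPoint λ_k).F`
  let v₀ : HeightOneSpectrum (𝓞 ℚ) := (Rat.HeightOneSpectrum.primesEquiv (R := 𝓞 ℚ)).symm ⟨7, by norm_num⟩
  have hv₀gen : Rat.HeightOneSpectrum.natGenerator v₀ = 7 := by
    have h := congrArg Subtype.val ((Rat.HeightOneSpectrum.primesEquiv (R := 𝓞 ℚ)).apply_symm_apply ⟨7, by norm_num⟩)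
    exact h
  have hv₀ : ((7 : ℕ) : 𝓞 ℚ) ∈ v₀.asIdeal := by
    rw [UniformABCConjecture.natCast_mem_asIdeal_iff, hv₀gen]
  have hram : ramIdx ℚ v₀ = 1 := by
    have h1 := ramificationIdx_int_le_finrank_rat (F₀ := ℚ) v₀
    rw [Module.finrank_self, ← ramIdx_eq] at h1
    have h2 : ramIdx ℚ v₀ ≠ 0 := ramIdx_ne_zero ℚ v₀
    omega
  have hv₀e : ¬ (7 : ℕ) ∣ ramIdx ℚ v₀ := by rw [hram]; decide
  have hm : Literature.IUT.LogVolume.ord ℚ v₀ (Cor22.jInv ((2 : ℚ)⁻¹ + 2 / 7 ^ k)) = -((2 * k : ℕ) : ℤ) := by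
    rw [Cor22.ord_jInv_lamSeven v₀ hv₀gen hk]; push_cast; ring
  have hP : ratPoint ((2 : ℚ)⁻¹ + 2 / 7 ^ k) ∈ UP := Cor22.ratPoint_lamSeven_mem_UP hk
  obtain ⟨x₀, hS, htame, hbound, hnorm⟩ :=
    GenuineK.exists_bad_tame_place_of_ord_neg T hP hl ⟨7, by norm_num⟩ (by norm_num) (by norm_num) (by norm_num)
      (show (7 : ℕ) ≠ l by omega) v₀ hv₀ hv₀e hm (by omega)
  -- read the outputs over `ℚ = (ratPoint λ_k).F` (definitional) and substitute `e(v₀|7) = 1`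
  have hb' : absRamificationIdx 7 (kOf (pilotDataOfK T.D T.K) 7 x₀) ≤ 46080 * (l * (l - 1) ^ 2 * (l + 1)) := by
    have h' : absRamificationIdx 7 (kOf (pilotDataOfK T.D T.K) 7 x₀) ≤ ramIdx ℚ v₀ * 46080 * (l * (l - 1) ^ 2 * (l + 1)) :=
      hbound
    rwa [hram, one_mul] at h'
  have hnorm' : ‖(exists_realising_qIdeles_pilotDataOfK T.D).choose ⟨7, by norm_num⟩ x₀‖ =
      (7 : ℝ) ^ (-(((2 * k : ℕ) : ℝ) / (2 * l * (ramIdx ℚ v₀ : ℝ)))) := hnorm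
  refine ⟨x₀, hS, htame, hb', ?_, ?_⟩
  · have h := differentOrd_add_logRadius_le_of_not_dvd 7 (kOf (pilotDataOfK T.D T.K) 7 x₀) (by norm_num) htame
    refine h.trans ?_
    have hlog7 : 0 < Real.log 7 := Real.log_pos (by norm_num)
    have he0 : 0 < absRamificationIdx 7 (kOf (pilotDataOfK T.D T.K) 7 x₀) := absRamificationIdx_pos _ _
    have hmono : Real.log (absRamificationIdx 7 (kOf (pilotDataOfK T.D T.K) 7 x₀)) ≤
        Real.log (((46080 * (l * (l - 1) ^ 2 * (l + 1)) : ℕ) : ℝ)) :=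
      Real.log_le_log (by exact_mod_cast he0) (by exact_mod_cast hb')
    have := div_le_div_of_nonneg_right hmono hlog7.le
    push_cast at this ⊢
    linarith
  · rw [hnorm', hram]
    congr 1
    have hl0 : (l : ℝ) ≠ 0 := by exact_mod_cast hl.ne_zero
    push_cast
    field_simp

/-- **THE ONE INTERFACE the «HEX-KERNEL» assembly (abc-iut-C-cert-1, H5) consumes**, verbatim in its binder order: for `k ≥ 1`, `l`
prime `≥ 11` and every genuine Θ-volume datum `T` at `(ratPoint λ_k, l)` there is a fibre point `x₀ | 7` with
`‖t_q(x₀)‖ ≤ 7^{−k/l}` for the CHOSEN realising q-idele (indeed `=`, `GenuineK.exists_place_lamSeven`).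
[cite: Mochizuki2012, IUTchIV Cor. 2.2 (ii) proof (P5) p. 46] [claim: Mochizuki2012, status: disputed] -/
theorem GenuineK.exists_norm_qIdele_le_lamSeven {k l : ℕ} (hk : 1 ≤ k) (hl : l.Prime) (h11 : 11 ≤ l)
    (T : Cor22.ThetaVolumeDatumAt (ratPoint ((2 : ℚ)⁻¹ + 2 / 7 ^ k)) l) :
    letI := T.instFieldF; letI := T.instNumberFieldF; letI := T.instAlgebraF; letI := T.instFieldK
    letI := T.instNumberFieldK; letI := T.instAlgebraK; letI := T.instFieldFbar; letI := T.instAlgebraFbar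
    letI := T.instAlgebraKFbar; letI := T.instIsElliptic
    ∃ x₀ : (thetaIndex (pilotDataOfK T.D T.K)).Fibre (.inr ⟨7, by norm_num⟩),
      ‖(exists_realising_qIdeles_pilotDataOfK T.D).choose ⟨7, by norm_num⟩ x₀‖ ≤ (7 : ℝ) ^ (-((k : ℝ) / l)) := by
  obtain ⟨x₀, -, -, -, -, h⟩ := GenuineK.exists_place_lamSeven hk hl h11 T
  exact ⟨x₀, h.le⟩

end Summit.ABC.IUTFork.Conditional

end
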